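import Literature.MathematicalPhysics.QuantumLattice.FockRelabel
import Literature.MathematicalPhysics.QuantumLattice.PairFieldMomentum
import Literature.MathematicalPhysics.QuantumLattice.HubbardWave0RepulsiveProofs
import HarnessLib

/-!
# Crux `MesoscopicPairOrder` (stmt-HubbardSuperconductivity-7331) — stationarity under ALL `N̂`-commuting `Q`
# characterises ground states (why SHARP box order is the crux again)

Supports item `stmt-HubbardSuperconductivity-7331` (route `FunctionFieldCertificate`, pole-free crux; open physics,
not settled here). The repaired window transfer (`mesoscopicPairOrder_of_sharpBoxOrder`) grants the box-order prover
a state `ρ` in ONE particle-number sector that is (S) stationary, `0 ≤ Re Tr ρ Qᴴ (HQ - QH)`, for EVERY matrix `Q`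
commuting with `N̂`. This file records the converse of the tree's `sectorStationarity` for pure states, which is
what makes the repaired residue a reformulation of the crux rather than a weakening:

* `vecMulVec_commute_totalNumberOp` — for `N`-particle vectors `χ, φ` the rank-one matrix `|χ⟩⟨φ|` commutes with `N̂`;
* `re_energy_le_of_stationary` — if a unit `N`-particle vector `φ` is stationary in the vector form
  `0 ≤ Re⟨Qφ, (HQ - QH)φ⟩` for every `Q` commuting with `N̂` (ANY matrix `H`), then `φ` MINIMISES the energy among
  the unit `N`-particle vectors: `Re⟨φ, Hφ⟩ ≤ Re⟨χ, Hχ⟩` (test `Q = |χ⟩⟨φ|`: `Qφ = χ`,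
  `(HQ - QH)φ = Hχ - ⟨φ, Hφ⟩ χ`);
* `stationaryPureStatesAreGroundStates` — registered form.

So the pure states admissible in sharp box order are exactly the global `N_L`-particle ground states (all `S^z`),
and by linearity the admissible density matrices are their translation-invariant mixtures: sharp box order at
`(R, R')` is the every-scale body of the crux at scale `R'` with threshold `L ≥ 2R + 2`.

Sources: Pironio–Navascués–Acín, SIAM J. Optim. 20 (2010) 2157 §2 (first-order optimality ⇔ ground state for the
full operator algebra); Tasaki (2020) §2.1 (variational principle). Folklore; no definition is introduced.
-/

noncomputable section

-- the summit namespace `Summit.HubbardSuperconductivity.HubbardSuperconductivity.…` repeats the problem name by design (D-0017)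
set_option linter.dupNamespace false

namespace Summit.HubbardSuperconductivity.HubbardSuperconductivity.Theorems.FunctionFieldCertificate

open Matrix Finset Filter
open Literature.Probability.LatticeModels Literature.MathematicalPhysics.QuantumLattice
open scoped ComplexOrder

variable {L : ℕ}

/-- For `N`-particle vectors `χ, φ` the rank-one matrix `|χ⟩⟨φ|` commutes with the number operator
(`N̂ |χ⟩⟨φ| = N |χ⟩⟨φ| = |χ⟩⟨φ| N̂`). [folklore] -/
theorem vecMulVec_commute_totalNumberOp {N : ℕ} {χ φ : Fock (Orb (FermionTorus 2 L))}
    (hχ : IsNParticle N χ) (hφ : IsNParticle N φ) :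
    Commute (vecMulVec χ (star φ)) (totalNumberOp : Matrix (Finset (Orb (FermionTorus 2 L))) _ ℂ) := by
  rw [totalNumberOp_eq_totalNumber]
  have hNχ : (totalNumber : Matrix (Finset (Orb (FermionTorus 2 L))) _ ℂ) *ᵥ χ = (N : ℂ) • χ :=
    (LiebTwo.isNParticle_iff_totalNumber N χ).1 hχ
  have hNφ : (totalNumber : Matrix (Finset (Orb (FermionTorus 2 L))) _ ℂ) *ᵥ φ = (N : ℂ) • φ :=
    (LiebTwo.isNParticle_iff_totalNumber N φ).1 hφ
  have hvec : star φ ᵥ* (totalNumber : Matrix (Finset (Orb (FermionTorus 2 L))) _ ℂ) = (N : ℂ) • star φ := by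
    have h1 : star φ ᵥ* (totalNumber : Matrix (Finset (Orb (FermionTorus 2 L))) _ ℂ) =
        star ((totalNumber : Matrix (Finset (Orb (FermionTorus 2 L))) _ ℂ)ᴴ *ᵥ φ) := by
      rw [star_mulVec, conjTranspose_conjTranspose]
    rw [h1, totalNumber_isHermitian.eq, hNφ, star_smul]
    congr 1
    simp
  change vecMulVec χ (star φ) * totalNumber = totalNumber * vecMulVec χ (star φ)
  rw [vecMulVec_mul, mul_vecMulVec, hvec, hNχ, vecMulVec_smul, smul_vecMulVec]

/-- **Stationarity under every `N̂`-commuting `Q` forces energy minimisation in the sector.** Let `φ` be a unit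
`N`-particle vector and `H` any matrix. If `0 ≤ Re⟨Qφ, (HQ - QH)φ⟩` for every `Q` commuting with `N̂`, then
`Re⟨φ, Hφ⟩ ≤ Re⟨χ, Hχ⟩` for every unit `N`-particle vector `χ` — the converse of the tree's `sectorStationarity`:
the pure stationary states are exactly the global `N`-particle ground states. (Test `Q = |χ⟩⟨φ|`.)
[folklore] -/
theorem re_energy_le_of_stationary {N : ℕ} {φ : Fock (Orb (FermionTorus 2 L))} (hφN : IsNParticle N φ)
    (hφ1 : star φ ⬝ᵥ φ = 1) (H : Matrix (Finset (Orb (FermionTorus 2 L))) (Finset (Orb (FermionTorus 2 L))) ℂ)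
    (hS : ∀ Q : Matrix (Finset (Orb (FermionTorus 2 L))) (Finset (Orb (FermionTorus 2 L))) ℂ,
      Commute Q totalNumberOp → 0 ≤ (star (Q *ᵥ φ) ⬝ᵥ ((H * Q - Q * H) *ᵥ φ)).re)
    (χ : Fock (Orb (FermionTorus 2 L))) (hχN : IsNParticle N χ) (hχ1 : star χ ⬝ᵥ χ = 1) :
    (star φ ⬝ᵥ H *ᵥ φ).re ≤ (star χ ⬝ᵥ H *ᵥ χ).re := by
  have h := hS (vecMulVec χ (star φ)) (vecMulVec_commute_totalNumberOp hχN hφN)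
  -- `Qφ = χ` and `Q(Hφ) = ⟨φ, Hφ⟩ χ`
  have hQφ : vecMulVec χ (star φ) *ᵥ φ = χ := by
    rw [vecMulVec_mulVec, hφ1]
    simp
  have hQH : vecMulVec χ (star φ) *ᵥ (H *ᵥ φ) = (star φ ⬝ᵥ H *ᵥ φ) • χ := by
    rw [vecMulVec_mulVec]
    simp
  rw [sub_mulVec, ← mulVec_mulVec, ← mulVec_mulVec, hQφ, hQH, dotProduct_sub, dotProduct_smul, hχ1,
    smul_eq_mul, mul_one, Complex.sub_re] at h
  linarith

/-- **Registered form** (sub-goal `stationaryPureStatesAreGroundStates` of crux stmt-HubbardSuperconductivity-7331, line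
`Sketch`; verbatim `re_energy_le_of_stationary`). [folklore] -/
theorem stationaryPureStatesAreGroundStates : ∀ {L : ℕ} {N : ℕ} {φ : Fock (Orb (FermionTorus 2 L))}, IsNParticle N φ → star φ ⬝ᵥ φ = 1 → ∀ H : Matrix (Finset (Orb (FermionTorus 2 L))) (Finset (Orb (FermionTorus 2 L))) ℂ, (∀ Q : Matrix (Finset (Orb (FermionTorus 2 L))) (Finset (Orb (FermionTorus 2 L))) ℂ, Commute Q totalNumberOp → 0 ≤ (star (Q *ᵥ φ) ⬝ᵥ ((H * Q - Q * H) *ᵥ φ)).re) → ∀ χ : Fock (Orb (FermionTorus 2 L)), IsNParticle N χ → star χ ⬝ᵥ χ = 1 → (star φ ⬝ᵥ H *ᵥ φ).re ≤ (star χ ⬝ᵥ H *ᵥ χ).re :=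
  fun hφN hφ1 H hS χ hχN hχ1 => re_energy_le_of_stationary hφN hφ1 H hS χ hχN hχ1

end Summit.HubbardSuperconductivity.HubbardSuperconductivity.Theorems.FunctionFieldCertificate
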